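import Summits.Ventures.PercRepro.ExcessOneComplexTrace

/-!
# The excess-one Lemma B at a tight trace containing `∅`: the uniform form

`partr_eq_insert_empty_partner_of_forall_notMem`: with `F` twin-free without trivial elements,
`∅ ∉ F`, `|F \\ F| = |F| + 1`, `{r} ∈ F`, `proj r F` tight and `partner r F` nonempty (of ANY
excess), if some `y ≠ r` lies in no partner member and in no type-I difference (no element of
`Y = partr r F \\ part0 r F`), then `partr r F = insert ∅ (partner r F)`. This is the uniform form
of proofs/MINE1-theoremS.md, Addendum 22, supplement 6: when the partner family has excess one
the second condition follows from the first (`Y = K \\ K`, `partr_eq_insert_empty_partner_of_not_cover`);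
when the partner family is tight, `Y` has one further element `E₀` and the condition asks
`y ∉ E₀` as well.
-/

namespace PercRepro.MSTight

open Finset
open scoped FinsetFamily

variable {α : Type*} [DecidableEq α] [Fintype α]

section ComplexTraceB

variable {F : Finset (Finset α)} {r : α}

/-- **The uniform form.** If `y ≠ r` lies in no partner member and in no element of `Y`, then
`partr r F = insert ∅ (partner r F)`. -/
theorem partr_eq_insert_empty_partner_of_forall_notMem
    (htf : ∀ a b, Twin F a b → a = b) (hnt : ∀ a, ∃ t ∈ F, a ∈ t)
    (hE : (∅ : Finset α) ∉ F) (hF : (F \\ F).card = F.card + 1)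
    (hP : Tight (proj r F)) (hr : ({r} : Finset α) ∈ F) (hne : (partner r F).Nonempty)
    {y : α} (hy : y ≠ r) (hyK : ∀ k ∈ partner r F, y ∉ k) (hyY : ∀ E ∈ diffsY r F, y ∉ E) :
    partr r F = insert ∅ (partner r F) := by
  have hcardY := card_diffsY_of_singleton_mem hP hr hF
  have h0 : (∅ : Finset α) ∈ partr r F := mem_partr.2 ⟨notMem_empty r, by simpa using hr⟩
  -- `y` lies in no member of `partr r F`
  have hyt : ∀ t ∈ partr r F, y ∉ t := by
    intro t ht hyt
    obtain ⟨k, hk⟩ := hne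
    have hk0 : k ∈ part0 r F := (mem_inter.1 hk).1
    have hts : t \ k ∈ diffsY r F := sdiff_mem_diffs ht hk0
    exact hyY _ hts (mem_sdiff.2 ⟨hyt, hyK k hk⟩)
  -- the singleton `{y}` is a member of the trace, hence of `part0 r F`
  have hyP : ({y} : Finset α) ∈ proj r F := by
    obtain ⟨t, ht, hyt'⟩ := hnt y
    have htP : t.erase r ∈ proj r F := mem_proj.2 ⟨t, ht, rfl⟩
    have h0P : (∅ : Finset α) ∈ proj r F := by
      rw [proj_eq_union]
      exact mem_union_right _ h0
    refine mem_of_subset_of_subset_of_twinClosed_of_tight hP h0P htP (empty_subset _) ?_ ?_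
    · intro z hz
      rw [mem_singleton] at hz
      rw [hz]
      exact mem_erase.2 ⟨hy, hyt'⟩
    · intro a b hab ha
      rw [mem_singleton] at ha ⊢
      rw [ha] at hab
      exact twin_proj_eq_of_twin_eq hy (fun b' hb' => (htf _ _ hb').symm) (hnt y) b hab
  have hy0 : ({y} : Finset α) ∈ part0 r F := by
    rw [proj_eq_union, mem_union] at hyP
    rcases hyP with h | h
    · exact h
    · exact absurd (mem_singleton_self y) (hyt _ h)
  -- `t ↦ t \ {y} = t` maps `partr r F` into `Y`
  have hsub : partr r F ⊆ diffsY r F := by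
    intro t ht
    have h : t \ {y} = t := sdiff_eq_self_iff_disjoint.2 (disjoint_singleton_right.2 (hyt t ht))
    rw [← h]
    exact sdiff_mem_diffs ht hy0
  have hle : (partr r F).card ≤ (partner r F).card + 1 := by
    have := card_le_card hsub
    omega
  have hKsub : insert ∅ (partner r F) ⊆ partr r F := by
    intro t ht
    rw [mem_insert] at ht
    rcases ht with rfl | ht
    · exact h0
    · exact (mem_inter.1 ht).2
  have h0K : (∅ : Finset α) ∉ partner r F := fun h => hE (mem_part0.1 (mem_inter.1 h).1).1
  have hcardK : (insert ∅ (partner r F)).card = (partner r F).card + 1 := card_insert_of_notMem h0K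
  exact (eq_of_subset_of_card_le hKsub (by omega)).symm

end ComplexTraceB

end PercRepro.MSTight
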